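import Literature.NumberTheory.Automorphic.RankinSelbergUniformBoundSL2
import Literature.NumberTheory.Automorphic.RankinSelbergGrowthSL2
import Literature.NumberTheory.EllipticCurves.NewformRankinSelbergTraceFricke
import Literature.NumberTheory.EllipticCurves.NewformPeterssonSizeSymmSquareProofs
import Literature.NumberTheory.EllipticCurves.NewformPeterssonSize
import Literature.NumberTheory.LFunctions.SiegelTheoremAbstract
import HarnessLib

/-!
# Murty's lower bound `(f, f) ≫_ε N^{1-ε}` for every newform whose Rankin–Selberg trace zeta
# function has no exceptional real zero (Siegel's theorem for `f × f̄` in the level aspect, case A)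

Topic `NumberTheory/EllipticCurves`; namespace `Literature.NumberTheory.EllipticCurves.ModularForms`.
Proof file (theorems only; no definition, no named fact), part of the `provefact` unit of the named
fact `murty_petersson_newform_lower_bound` (`NewformPeterssonSize.lean`: for the newform `f` of an
elliptic curve of conductor `N`, `Re (f, f)_{Γ₀(N)} ≥ c(ε) N^{1-ε}`; Murty 1999, §2, quoting
Hoffstein–Lockhart 1994). The tree already reduces the fact EXACTLY to Hoffstein–Lockhart's bound
`L(1, Sym² f)·(bad factors) ≫_ε N^{-ε}` (`NewformPeterssonSizeRankinSelbergProofs`,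
`NewformPeterssonSizeSymmSquareProofs`, and the converse `…SymmSquareConverseProofs`). Hoffstein–
Lockhart's proof is Siegel's: (A) if the relevant `L`-function has no real zero near `1`, a lower
bound `≫ N^{-ε}` (indeed `≫ 1/log N`) follows from Estermann's lemma; (B) if it has one, Siegel's
ineffective argument with the auxiliary function `ζ L(Sym² f₀)L(Sym² g)L(Sym² f₀ × Sym² g)` — a
`GL(3) × GL(3)` object not available in the tree. This file PROVES case (A) in the following
honest form, for EVERY newform of weight `2` on `Γ₀(N)` (no elliptic curve is needed):

* `IsNewform0.petersson_lower_bound_of_zeroFree` — for every `ε > 0` there is `δ₁ > 0` such that for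
  all `0 < δ ≤ δ₁` there is `c > 0` with: for every `N` and every newform `f ∈ S₂(Γ₀(N))` whose
  completed trace zeta function
  `Z_f(s) = s(s − 1) ∫_𝒟 G_f E₀*(·, s) dμ + ½ ∫_𝒟 G_f dμ`
  (`G_f = rsTrace N 2 f`, the `SL₂(ℤ)`-trace of `|f|²y²`, `CuspFormRankinSelbergTrace`; `E₀*` the
  entire part of the completed level-one Eisenstein series, `ModularEisensteinContinuation`;
  `Z_f = s(s−1)∫_𝒟 G_f E*(·,s) dμ` is entire, real on `ℝ`, `Z_f(1) = (f,f)/2 > 0`, and for `Re s > 1`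
  `Z_f(s) = s(s−1) π^{-s}Γ(s)Γ(s+1)ζ(2s)(4π/N)^{-(s+1)} Σₙ rsCoeff(n) n^{-(s+1)}`, Rankin 1939) has
  NO ZERO on `[1 − δ, 1]`, one has `c N^{1−ε} ≤ Re (f, f)_{Γ₀(N)}`;
* `traceZeta_eq_mul_integral_completedEisenstein` — `Z_f(s) = s(s−1)∫_𝒟 G_f E*(·,s) dμ` for
  `s ≠ 0, 1` (`E*` the completed level-one Eisenstein series, `completedEisenstein_eq`);
* `IsNewform0.petersson_lower_bound_log_of_zeroFree` — the EFFECTIVE form: absolute `A₀, c > 0`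
  with `c N/log(N+2) ≤ Re (f,f)` for every newform `f ∈ S₂(Γ₀(N))` such that `Z_f(σ) ≠ 0` for
  `1 − 1/(A₀ log(N+2)) ≤ σ ≤ 1` (Hoffstein–Lockhart 1994, p. 161: "it is easy to show
  `1/log N ≪ L(1, Sym² f)` provided there is no Siegel zero");
* `IsNewform0.petersson_lower_bound_log_of_zeroFree'` — the same for EVERY `A ≥ A₀` (narrower
  interval, weaker hypothesis, constant `c(A)`), the shape of a published zero-free region;
* `IsNewformOf.petersson_lower_bound_of_zeroFree` — the power form for the newform of `E/ℚ`;
* `murty_petersson_newform_lower_bound_of_noExceptionalZero` — hence the named fact, CONDITIONALLY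
  on a de la Vallée-Poussin-type zero-free interval `[1 − 1/(A log(N+2)), 1]` of `Z_f` for the
  newforms of elliptic curves (some `A > 0`; Goldfeld–Hoffstein–Lieman's and Hoffstein–Ramakrishnan's
  "no Siegel zero for `Sym² f`" is the published reason this holds; not formalized); and
  `murty_petersson_newform_lower_bound_of_trace_zeroFree` — the same from a uniform `δ₀ > 0`.

The engine (all inputs are in the tree):
1. `exists_norm_J₀_le_uniform` (`RankinSelbergUniformBoundSL2`): `|J₀(s)| ≤ Q(1 + N/(4π))⁴ (f,f)`
   on `-1/2 ≤ Re s ≤ 7/2`, `J₀(s) = ∫_𝒟 G_f E₀*(·,s)`, `Q` absolute;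
2. `IsNewform0.inv_le_rsCoeff_one` (`NewformRankinSelbergTraceFricke`): `C₁ = rsCoeff N 2 f 1 ≥ 1/N`
   (the `N` Fricke cosets), and `peterssonProduct_self_re_eq_integral_rsTrace`: `Re(f,f) = ∫_𝒟 G_f`;
3. `H_f(s) = Z_f(s)(4π/N)^{s+1}π^s/(Γ(s+1)²ζ(2s)C₁)` is `(s − 1)Σ (rsCoeff(n)/(nC₁)) n^{-s}` on
   `Re s > 1` (`H_eq_sub_one_mul_LSeries`, from `g_eq_of_one_lt_re` of `RankinSelbergGrowthSL2`),
   holomorphic on `Re s > 1/2` (`differentiableOn_H`), real on the real axis (`H_ofReal_im`),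
   `H_f(1) = 3a²V/(πC₁) = 48π(f,f)/(N²C₁) ≤ 48π(f,f)/N` (`H_one`), `|H_f| ≤ K N⁵ (f,f)` on
   `|s − 2| ≤ 5/4` (`norm_H_le`);
4. Estermann's lemma on the disc `|s − 2| ≤ 5/4` (`EstermannDisc.exists_estermann_constants`,
   Montgomery–Vaughan Lemma 11.13) with `β = 1 − δ`, where `Re H_f(1 − δ) ≥ 0` by zero-freeness,
   reality and `H_f(1) > 0` (`re_pos_of_forall_ne_zero`): `48π(f,f)/N ≥ c_E δ max(1, KN⁵(f,f))^{-A_Eδ}`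
   (`estermann_bound_of_zeroFree`, `exists_trace_estermann_ineq`), whence `(f,f) ≥ c N^{1−6A_Eδ}`
   (`lower_bound_of_estermann_ineq`), resp. `(f,f) ≥ c δ N` for `δ = 1/(A₀ log(N+2))`
   (`lower_bound_log_of_estermann_ineq`).

## References

* [HoffsteinLockhart1994] J. Hoffstein, P. Lockhart, *Coefficients of Maass forms and the Siegel
  zero*, Ann. of Math. 140 (1994), 161–181, Thm. 0.1 and the appendix by Goldfeld–Hoffstein–Lieman.
* [Murty1999CongruencePrimes] M. R. Murty, *Bounds for congruence primes*, Proc. Sympos. Pure Math.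
  66.1 (1999), §2 p. 7 ("By a result of Hoffstein and Lockhart, `log (f,f) > (1−ε) log N`").
* [MontgomeryVaughan2007] H. L. Montgomery, R. C. Vaughan, *Multiplicative Number Theory I*, CUP
  2007, §11.2, Lemma 11.13 and the proof of Theorem 11.14 (case of no exceptional zero).
* [Rankin1939] R. A. Rankin, Proc. Cambridge Philos. Soc. 35 (1939), 357–372, §4.
* [AtkinLehner1970] A. O. L. Atkin, J. Lehner, Math. Ann. 185 (1970), Thm. 3.
-/

noncomputable section

namespace Literature.NumberTheory.EllipticCurves.ModularForms

open Literature.NumberTheory.Automorphic Literature.NumberTheory.LFunctions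
open _root_.MeasureTheory Set Filter Real Complex Metric ModularForm CongruenceSubgroup
open UpperHalfPlane hiding I
open scoped Topology MatrixGroups ModularForm ComplexOrder

/-! ### The horocycle datum of the trace `G_f` (`κ = 2`, `a = 4π/N`) -/

section Datum

variable {N : ℕ} [NeZero N] (f : CuspForm (Gamma0 N) 2)

/-- Summability of the Laplace series of the trace coefficients, `a = 4π/N`. [folklore] -/
theorem summable_rsCoeff_mul_exp_datum {y : ℝ} (hy : 0 < y) :
    Summable fun n : ℕ ↦ rsCoeff N 2 f n * Real.exp (-(4 * Real.pi / N) * n * y) := by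
  have h := summable_rsCoeff_mul_exp f hy
  refine h.congr fun n ↦ ?_
  congr 1
  congr 1
  ring

/-- The horocycle identity of the trace in the datum normalisation:
`∫₀¹ G_f(x+iy) dx = y² Σ rsCoeff(n) e^{-(4π/N) n y}`. [cite: Rankin1939, §4.2 (4.2.3)] -/
theorem horocycle_rsTrace_datum {y : ℝ} (hy : 0 < y) :
    ∫ x in (0 : ℝ)..1, rsTrace N 2 f (pt x y) =
      y ^ (2 : ℝ) * ∑' n : ℕ, rsCoeff N 2 f n * Real.exp (-(4 * Real.pi / N) * n * y) := by
  have hexp : ∀ n : ℕ, Real.exp (-(4 * Real.pi / N) * n * y) = Real.exp (-(4 * Real.pi * n / N) * y) := by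
    intro n; congr 1; ring
  simp_rw [hexp]
  have hpt : ∀ x : ℝ, pt x y = ofComplex ((x : ℂ) + y * Complex.I) := by
    intro x; rw [pt, Complex.mk_eq_add_mul_I]
  simp_rw [hpt]
  rw [intervalIntegral_rsTrace_horizontal f hy, Real.rpow_two, ← zpow_ofNat]

/-- The bound `Σ rsCoeff(n) e^{-any} ≤ B y^{-2}` in the datum normalisation. [folklore] -/
theorem tsum_rsCoeff_mul_exp_le_datum {B : ℝ} (hB : ∀ τ : ℍ, rsTrace N 2 f τ ≤ B) {y : ℝ}
    (hy : 0 < y) :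
    ∑' n : ℕ, rsCoeff N 2 f n * Real.exp (-(4 * Real.pi / N) * n * y) ≤ B * y ^ (-(2 : ℝ)) := by
  have hexp : ∀ n : ℕ, Real.exp (-(4 * Real.pi / N) * n * y) = Real.exp (-(4 * Real.pi * n / N) * y) := by
    intro n; congr 1; ring
  simp_rw [hexp]
  have h := tsum_rsCoeff_mul_exp_le f hB hy
  rwa [Real.rpow_neg hy.le, Real.rpow_two, ← zpow_ofNat, ← div_eq_mul_inv]

end Datum

/-! ### The function `H_f` and its properties -/

section Engine

variable {N : ℕ} [NeZero N]

/-- On the closed disc `|s − 2| ≤ 5/4`: `3/4 ≤ Re s ≤ 13/4` and `|Im s| ≤ 5/4`, `‖s‖ ≤ 13/4 + 5/4`.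
[folklore] -/
theorem re_bounds_of_mem_closedBall {s : ℂ} (hs : s ∈ closedBall (2 : ℂ) (5 / 4)) :
    3 / 4 ≤ s.re ∧ s.re ≤ 13 / 4 ∧ ‖s‖ ≤ 9 / 2 ∧ ‖s - 1‖ ≤ 9 / 4 := by
  rw [mem_closedBall, dist_eq_norm] at hs
  have hre : |s.re - 2| ≤ 5 / 4 := by
    have := Complex.abs_re_le_norm (s - 2)
    simpa using this.trans hs
  rw [abs_le] at hre
  refine ⟨by linarith, by linarith, ?_, ?_⟩
  · calc ‖s‖ = ‖(s - 2) + 2‖ := by ring_nf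
      _ ≤ ‖s - 2‖ + ‖(2 : ℂ)‖ := norm_add_le _ _
      _ ≤ 5 / 4 + 2 := by gcongr; simp
      _ ≤ 9 / 2 := by norm_num
  · calc ‖s - 1‖ = ‖(s - 2) + 1‖ := by ring_nf
      _ ≤ ‖s - 2‖ + ‖(1 : ℂ)‖ := norm_add_le _ _
      _ ≤ 5 / 4 + 1 := by gcongr; simp
      _ = 9 / 4 := by norm_num

/-- An absolute bound for `‖Γ(s+1)⁻¹‖` on the disc `|s − 2| ≤ 5/4` (compactness; `Γ` has no zeros).
[folklore] -/
theorem exists_norm_inv_Gamma_add_one_le :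
    ∃ K : ℝ, 0 < K ∧ ∀ s ∈ closedBall (2 : ℂ) (5 / 4), ‖(Complex.Gamma (s + 1))⁻¹‖ ≤ K := by
  have hcont : ContinuousOn (fun s : ℂ ↦ (Complex.Gamma (s + 1))⁻¹) (closedBall (2 : ℂ) (5 / 4)) := by
    refine fun s hs ↦ ContinuousAt.continuousWithinAt ?_
    have hre := (re_bounds_of_mem_closedBall hs).1
    have hne : Complex.Gamma (s + 1) ≠ 0 :=
      Complex.Gamma_ne_zero_of_re_pos (by simp; linarith)
    refine ContinuousAt.inv₀ ?_ hne
    refine (Complex.differentiableAt_Gamma _ fun m ↦ ?_).continuousAt.comp (f := fun s : ℂ ↦ s + 1)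
      (by fun_prop)
    intro h
    have := congrArg Complex.re h
    simp at this
    linarith
  obtain ⟨K, hK⟩ := (isCompact_closedBall (2 : ℂ) (5 / 4)).exists_bound_of_continuousOn hcont
  refine ⟨max K 1, by positivity, fun s hs ↦ (hK s hs).trans (le_max_left _ _)⟩

end Engine

/-! ### The abstract engine: the function `H` attached to an entire `J` -/

section Abstract

variable {C : ℕ → ℝ} {a V C₁ : ℝ} {J : ℂ → ℂ}

/-- The Dirichlet coefficients `A(n) = C(n)/(n C₁)` are non-negative. [folklore] -/
theorem coeffA_nonneg (hC : ∀ n, 0 ≤ C n) (hC1 : 0 < C₁) :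
    0 ≤ (fun n : ℕ ↦ (((C n / (n * C₁)) : ℝ) : ℂ)) := by
  intro n
  simp only [Pi.zero_apply]
  exact_mod_cast div_nonneg (hC n) (by positivity)

/-- `A(1) = 1` when `C(1) = C₁`. [folklore] -/
theorem coeffA_one (hC1 : 0 < C₁) (h1 : C 1 = C₁) :
    (fun n : ℕ ↦ (((C n / (n * C₁)) : ℝ) : ℂ)) 1 = 1 := by
  simp only [Nat.cast_one, one_mul, h1, div_self hC1.ne']
  norm_num

/-- `LSeries A s = LSeries C (s+1) / C₁` (termwise `C(n)/(nC₁) n^{-s} = C(n) n^{-(s+1)}/C₁`).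
[folklore] -/
theorem LSeries_coeffA_eq (hC1 : 0 < C₁) (s : ℂ) :
    LSeries (fun n : ℕ ↦ (((C n / (n * C₁)) : ℝ) : ℂ)) s =
      LSeries (fun n ↦ (C n : ℂ)) (s + 1) / C₁ := by
  rw [LSeries, LSeries, div_eq_mul_inv, ← tsum_mul_right]
  refine tsum_congr fun n ↦ ?_
  rcases Nat.eq_zero_or_pos n with rfl | hn
  · simp [LSeries.term_zero]
  · have hn0 : (n : ℂ) ≠ 0 := by exact_mod_cast hn.ne'
    have hC1c : (C₁ : ℂ) ≠ 0 := by exact_mod_cast hC1.ne'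
    rw [LSeries.term_of_ne_zero hn.ne', LSeries.term_of_ne_zero hn.ne', Complex.cpow_add _ _ hn0,
      Complex.cpow_one]
    push_cast
    field_simp

/-- Summability transfers from `C` at `s + 1` to `A` at `s`. [folklore] -/
theorem LSeriesSummable_coeffA (hC1 : 0 < C₁) {s : ℂ}
    (hsum : LSeriesSummable (fun n ↦ (C n : ℂ)) (s + 1)) :
    LSeriesSummable (fun n : ℕ ↦ (((C n / (n * C₁)) : ℝ) : ℂ)) s := by
  rw [LSeriesSummable] at hsum ⊢
  have h := hsum.mul_right ((C₁ : ℂ)⁻¹)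
  refine h.congr fun n ↦ ?_
  rcases Nat.eq_zero_or_pos n with rfl | hn
  · simp [LSeries.term_zero]
  · have hn0 : (n : ℂ) ≠ 0 := by exact_mod_cast hn.ne'
    have hC1c : (C₁ : ℂ) ≠ 0 := by exact_mod_cast hC1.ne'
    rw [LSeries.term_of_ne_zero hn.ne', LSeries.term_of_ne_zero hn.ne', Complex.cpow_add _ _ hn0,
      Complex.cpow_one]
    push_cast
    field_simp

/-- **`H(s) = (s − 1) LSeries A s` on `Re s > 1`**, where
`H(s) = (s(s−1)J(s) + V/2) a^{s+1} π^s / (Γ(s+1)² ζ(2s) C₁)` and `J` satisfies the Rankin–Selberg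
identity `J(s) = π^{-s}Γ(s)ζ(2s)Γ(s+1)a^{-(s+1)}D(s+1) + (1/(2s) + 1/(2(1-s)))V` there
(`g_eq_of_one_lt_re` of `RankinSelbergGrowthSL2`, `Γ(s+1) = sΓ(s)`). [cite: Rankin1939, §4.4] -/
theorem H_eq_sub_one_mul_LSeries (ha : 0 < a) (hC1 : 0 < C₁)
    (hJeq : ∀ s : ℂ, 1 < s.re → J s = (π : ℂ) ^ (-s) * Complex.Gamma s * riemannZeta (2 * s) *
      (Complex.Gamma (s + 1) * (a : ℂ) ^ (-(s + 1)) * LSeries (fun n ↦ (C n : ℂ)) (s + 1)) +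
        (1 / (2 * s) + 1 / (2 * (1 - s))) * (V : ℂ))
    {s : ℂ} (hs : 1 < s.re) :
    (s * (s - 1) * J s + V / 2) * ((a : ℂ) ^ (s + 1) * (π : ℂ) ^ s) /
        ((Complex.Gamma (s + 1)) ^ 2 * riemannZeta (2 * s) * C₁) =
      (s - 1) * LSeries (fun n : ℕ ↦ (((C n / (n * C₁)) : ℝ) : ℂ)) s := by
  have hg := g_eq_of_one_lt_re (V := (V : ℂ)) hJeq hs
  have hs0 : s ≠ 0 := fun h ↦ by rw [h, Complex.zero_re] at hs; linarith
  have hΓ : Complex.Gamma s ≠ 0 := Complex.Gamma_ne_zero_of_re_pos (by linarith)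
  have hΓ1 : Complex.Gamma (s + 1) ≠ 0 := Complex.Gamma_ne_zero_of_re_pos (by simp; linarith)
  have hζ : riemannZeta (2 * s) ≠ 0 := riemannZeta_ne_zero_of_one_le_re (by simp; linarith)
  have hac : (a : ℂ) ≠ 0 := by exact_mod_cast ha.ne'
  have hπ : (π : ℂ) ≠ 0 := by exact_mod_cast Real.pi_pos.ne'
  have hC1c : (C₁ : ℂ) ≠ 0 := by exact_mod_cast hC1.ne'
  have has : (a : ℂ) ^ (s + 1) ≠ 0 := by
    rw [Ne, Complex.cpow_eq_zero_iff]; exact fun h ↦ hac h.1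
  have hπs : (π : ℂ) ^ s ≠ 0 := by
    rw [Ne, Complex.cpow_eq_zero_iff]; exact fun h ↦ hπ h.1
  set L := LSeries (fun n ↦ (C n : ℂ)) (s + 1) with hL
  have hZ : s * (s - 1) * J s + V / 2 =
      s * (s - 1) * (π : ℂ) ^ (-s) * riemannZeta (2 * s) * (a : ℂ) ^ (-(s + 1)) * L *
        Complex.Gamma s * Complex.Gamma (s + 1) := by
    rw [← hg]; field_simp
  rw [LSeries_coeffA_eq hC1, ← hL, hZ, Complex.Gamma_add_one s hs0, Complex.cpow_neg, Complex.cpow_neg]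
  set Z2 := riemannZeta (2 * s) with hZ2
  set P := (a : ℂ) ^ (s + 1) with hP
  set Q := (π : ℂ) ^ s with hQ
  set G := Complex.Gamma s with hG
  field_simp

/-- **`H` is holomorphic on `Re s > 1/2`** (`J` entire; `Γ(s+1) ≠ 0` and `ζ(2s) ≠ 0` there). [folklore] -/
theorem differentiableOn_H (ha : 0 < a) (hC1 : 0 < C₁) (hJ : Differentiable ℂ J) :
    DifferentiableOn ℂ (fun s : ℂ ↦ (s * (s - 1) * J s + V / 2) * ((a : ℂ) ^ (s + 1) * (π : ℂ) ^ s) /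
        ((Complex.Gamma (s + 1)) ^ 2 * riemannZeta (2 * s) * C₁)) {s : ℂ | 1 / 2 < s.re} := by
  intro s hs
  have hs' : 1 / 2 < s.re := hs
  have hac : (a : ℂ) ≠ 0 := by exact_mod_cast ha.ne'
  have hπ : (π : ℂ) ≠ 0 := by exact_mod_cast Real.pi_pos.ne'
  have hC1c : (C₁ : ℂ) ≠ 0 := by exact_mod_cast hC1.ne'
  have hΓ1 : Complex.Gamma (s + 1) ≠ 0 := Complex.Gamma_ne_zero_of_re_pos (by simp; linarith)
  have hζ : riemannZeta (2 * s) ≠ 0 := riemannZeta_ne_zero_of_one_le_re (by simp; linarith)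
  refine DifferentiableAt.differentiableWithinAt ?_
  refine DifferentiableAt.div ?_ ?_ (mul_ne_zero (mul_ne_zero (pow_ne_zero 2 hΓ1) hζ) hC1c)
  · refine DifferentiableAt.mul ?_ ?_
    · exact (((differentiableAt_id.mul (differentiableAt_id.sub_const 1)).mul
        hJ.differentiableAt).add_const _)
    · refine DifferentiableAt.mul ?_ ?_
      · exact (differentiableAt_id.add_const 1).const_cpow (Or.inl hac)
      · exact differentiableAt_id.const_cpow (Or.inl hπ)
  · refine DifferentiableAt.mul (DifferentiableAt.mul ?_ ?_) (differentiableAt_const _)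
    · refine DifferentiableAt.pow ?_ 2
      have hG : DifferentiableAt ℂ Complex.Gamma (s + 1) := by
        refine Complex.differentiableAt_Gamma _ fun m h ↦ ?_
        have := congrArg Complex.re h
        simp at this
        linarith
      exact hG.comp s (differentiableAt_id.add_const 1)
    · have h2 : 2 * s ≠ 1 := by
        intro h
        have := congrArg Complex.re h
        simp at this
        linarith
      exact (differentiableAt_riemannZeta h2).comp s (differentiableAt_id.const_mul _)

/-- **The value at `1`**: `H(1) = 3a²V/(πC₁)` (`Γ(2) = 1`, `ζ(2) = π²/6`). [folklore] -/
theorem H_one (ha : 0 < a) (hC1 : 0 < C₁) :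
    ((1 : ℂ) * (1 - 1) * J 1 + V / 2) * ((a : ℂ) ^ ((1 : ℂ) + 1) * (π : ℂ) ^ (1 : ℂ)) /
        ((Complex.Gamma (1 + 1)) ^ 2 * riemannZeta (2 * 1) * C₁) =
      ((3 * a ^ 2 * V / (π * C₁) : ℝ) : ℂ) := by
  have hπ : (π : ℂ) ≠ 0 := by exact_mod_cast Real.pi_pos.ne'
  have hC1c : (C₁ : ℂ) ≠ 0 := by exact_mod_cast hC1.ne'
  have hΓ2 : Complex.Gamma 2 = 1 := by
    rw [show (2 : ℂ) = ((1 : ℕ) : ℂ) + 1 by norm_num, Complex.Gamma_nat_eq_factorial]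
    simp
  rw [show (1 : ℂ) + 1 = 2 by norm_num, mul_one, Complex.cpow_two, Complex.cpow_one,
    hΓ2, riemannZeta_two]
  push_cast
  field_simp
  ring

/-- **The bound on the disc `|s − 2| ≤ 5/4`**: with `‖J‖ ≤ M_J` there and `‖Γ(s+1)⁻¹‖ ≤ K_Γ`,
`‖H(s)‖ ≤ ((9/2)(9/4)M_J + |V|/2) (max 1 a)^{17/4} π^{13/4} K_Γ² K_ζ / C₁`, `K_ζ = Σ n^{-3/2}`. [folklore] -/
theorem norm_H_le (ha : 0 < a) (hC1 : 0 < C₁) {MJ KΓ : ℝ} (hMJ : 0 ≤ MJ)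
    (hJbd : ∀ s ∈ closedBall (2 : ℂ) (5 / 4), ‖J s‖ ≤ MJ)
    (hΓbd : ∀ s ∈ closedBall (2 : ℂ) (5 / 4), ‖(Complex.Gamma (s + 1))⁻¹‖ ≤ KΓ)
    {s : ℂ} (hs : s ∈ closedBall (2 : ℂ) (5 / 4)) :
    ‖(s * (s - 1) * J s + V / 2) * ((a : ℂ) ^ (s + 1) * (π : ℂ) ^ s) /
        ((Complex.Gamma (s + 1)) ^ 2 * riemannZeta (2 * s) * C₁)‖ ≤
      (9 / 2 * (9 / 4) * MJ + |V| / 2) * ((max 1 a) ^ (17 / 4 : ℝ) * π ^ (13 / 4 : ℝ)) *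
        (KΓ ^ 2 * (∑' n : ℕ, (n : ℝ) ^ (-(3 / 2 : ℝ))) / C₁) := by
  obtain ⟨hre1, hre2, hn1, hn2⟩ := re_bounds_of_mem_closedBall hs
  have hΓ1 : Complex.Gamma (s + 1) ≠ 0 := Complex.Gamma_ne_zero_of_re_pos (by simp; linarith)
  have hζ : riemannZeta (2 * s) ≠ 0 := riemannZeta_ne_zero_of_one_le_re (by simp; linarith)
  have hC1c : (C₁ : ℂ) ≠ 0 := by exact_mod_cast hC1.ne'
  -- the numerator
  have hZ : ‖s * (s - 1) * J s + V / 2‖ ≤ 9 / 2 * (9 / 4) * MJ + |V| / 2 := by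
    refine (norm_add_le _ _).trans (add_le_add ?_ ?_)
    · rw [norm_mul, norm_mul]
      have := hJbd s hs
      gcongr
    · rw [norm_div, Complex.norm_real, Real.norm_eq_abs]
      simp
  have hcp : ‖(a : ℂ) ^ (s + 1) * (π : ℂ) ^ s‖ ≤ (max 1 a) ^ (17 / 4 : ℝ) * π ^ (13 / 4 : ℝ) := by
    rw [norm_mul, Complex.norm_cpow_eq_rpow_re_of_pos ha, Complex.norm_cpow_eq_rpow_re_of_pos Real.pi_pos]
    have h1 : a ^ (s + 1).re ≤ (max 1 a) ^ (17 / 4 : ℝ) := by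
      have hm : (1 : ℝ) ≤ max 1 a := le_max_left _ _
      calc a ^ (s + 1).re ≤ (max 1 a) ^ (s + 1).re :=
            Real.rpow_le_rpow ha.le (le_max_right _ _) (by simp; linarith)
        _ ≤ (max 1 a) ^ (17 / 4 : ℝ) := Real.rpow_le_rpow_of_exponent_le hm (by simp; linarith)
    have h2 : π ^ s.re ≤ π ^ (13 / 4 : ℝ) :=
      Real.rpow_le_rpow_of_exponent_le (by linarith [Real.pi_gt_three]) hre2
    gcongr
  -- the denominator
  have hden : ‖((Complex.Gamma (s + 1)) ^ 2 * riemannZeta (2 * s) * C₁)⁻¹‖ ≤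
      KΓ ^ 2 * (∑' n : ℕ, (n : ℝ) ^ (-(3 / 2 : ℝ))) / C₁ := by
    rw [mul_inv, mul_inv, norm_mul, norm_mul, ← inv_pow, norm_pow, norm_inv (C₁ : ℂ), Complex.norm_real,
      Real.norm_of_nonneg hC1.le, div_eq_mul_inv]
    have h1 : ‖(Complex.Gamma (s + 1))⁻¹‖ ^ 2 ≤ KΓ ^ 2 := by
      have := hΓbd s hs
      gcongr
    have h2 : ‖(riemannZeta (2 * s))⁻¹‖ ≤ ∑' n : ℕ, (n : ℝ) ^ (-(3 / 2 : ℝ)) :=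
      norm_inv_riemannZeta_le (σ₀ := 3 / 2) (by norm_num) (by simp; linarith)
    gcongr
  rw [div_eq_mul_inv, norm_mul, norm_mul]
  have hKζ : 0 ≤ ∑' n : ℕ, (n : ℝ) ^ (-(3 / 2 : ℝ)) := tsum_nonneg fun n ↦ Real.rpow_nonneg (Nat.cast_nonneg n) _
  gcongr

/-- **`H` is real on the real axis** (`σ > 1/2`), provided `J(σ)` is. [folklore] -/
theorem H_ofReal_im (ha : 0 < a) (hJreal : ∀ σ : ℝ, (J σ).im = 0) {σ : ℝ} (hσ : 1 / 2 < σ) :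
    (((σ : ℂ) * (σ - 1) * J σ + V / 2) * ((a : ℂ) ^ ((σ : ℂ) + 1) * (π : ℂ) ^ (σ : ℂ)) /
        ((Complex.Gamma (σ + 1)) ^ 2 * riemannZeta (2 * σ) * C₁)).im = 0 := by
  have hJ : J σ = (((J σ).re : ℝ) : ℂ) := Complex.ext (by simp) (by simp [hJreal σ])
  have hζ : riemannZeta (2 * (σ : ℂ)) = (((riemannZeta (2 * (σ : ℂ))).re : ℝ) : ℂ) := by
    have h := riemannZeta_ofReal_eq_tsum (s := 2 * σ) (by linarith)
    have e : (2 : ℂ) * σ = ((2 * σ : ℝ) : ℂ) := by push_cast; ring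
    rw [e, h, Complex.ofReal_re]
  have hΓ : Complex.Gamma ((σ : ℂ) + 1) = ((Real.Gamma (σ + 1) : ℝ) : ℂ) := by
    rw [← Complex.Gamma_ofReal]; push_cast; rfl
  have hac : (a : ℂ) ^ ((σ : ℂ) + 1) = ((a ^ (σ + 1) : ℝ) : ℂ) := by
    rw [Complex.ofReal_cpow ha.le]; push_cast; rfl
  have hπc : (π : ℂ) ^ (σ : ℂ) = ((π ^ σ : ℝ) : ℂ) := by
    rw [Complex.ofReal_cpow Real.pi_pos.le]
  rw [hJ, hζ, hΓ, hac, hπc]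
  set r1 : ℝ := (J σ).re
  set r2 : ℝ := (riemannZeta (2 * (σ : ℂ))).re
  have : (((σ : ℂ) * (σ - 1) * (r1 : ℂ) + V / 2) * (((a ^ (σ + 1) : ℝ) : ℂ) * ((π ^ σ : ℝ) : ℂ)) /
      ((((Real.Gamma (σ + 1) : ℝ) : ℂ)) ^ 2 * (r2 : ℂ) * C₁)) =
      (((σ * (σ - 1) * r1 + V / 2) * (a ^ (σ + 1) * π ^ σ) / ((Real.Gamma (σ + 1)) ^ 2 * r2 * C₁) : ℝ) : ℂ) := by
    push_cast; ring
  rw [this, Complex.ofReal_im]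

/-- **Estermann's lemma for `H`** (the abstract package): under the Rankin–Selberg hypotheses on
`J` (entire, the identity on `Re s > 1`, real on the real axis, bounded by `M_J` on the disc),
positivity `V > 0`, `C ≥ 0` with `C(1) = C₁ > 0`, the bound
`((9/2)(9/4)M_J + |V|/2)(max 1 a)^{17/4}π^{13/4}K_Γ²K_ζ/C₁ ≤ M` (`M ≥ 1`), and NO ZERO of
`Z(σ) = σ(σ−1)J(σ) + V/2` on `[1 − η, 1]` (`0 < η ≤ 1/8`), Estermann's lemma on `|s − 2| ≤ 5/4`
gives `c_E η M^{−A_E η} ≤ H(1) = 3a²V/(πC₁)`. [cite: MontgomeryVaughan2007, §11.2 Lemma 11.13] -/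
theorem estermann_bound_of_zeroFree (hC : ∀ n, 0 ≤ C n) (ha : 0 < a) (hC1 : 0 < C₁) (h1 : C 1 = C₁)
    (hV : 0 < V) (hJ : Differentiable ℂ J)
    (hJeq : ∀ s : ℂ, 1 < s.re → J s = (π : ℂ) ^ (-s) * Complex.Gamma s * riemannZeta (2 * s) *
      (Complex.Gamma (s + 1) * (a : ℂ) ^ (-(s + 1)) * LSeries (fun n ↦ (C n : ℂ)) (s + 1)) +
        (1 / (2 * s) + 1 / (2 * (1 - s))) * (V : ℂ))
    (hsum : ∀ s : ℂ, 1 < s.re → LSeriesSummable (fun n ↦ (C n : ℂ)) (s + 1))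
    (hJreal : ∀ σ : ℝ, (J σ).im = 0)
    {MJ KΓ : ℝ} (hMJ : 0 ≤ MJ) (hJbd : ∀ s ∈ closedBall (2 : ℂ) (5 / 4), ‖J s‖ ≤ MJ)
    (hΓbd : ∀ s ∈ closedBall (2 : ℂ) (5 / 4), ‖(Complex.Gamma (s + 1))⁻¹‖ ≤ KΓ)
    {cE AE : ℝ}
    (hEst : ∀ ⦃U : Set ℂ⦄ ⦃H : ℂ → ℂ⦄ ⦃M : ℝ⦄, IsOpen U → closedBall (2 : ℂ) (5 / 4) ⊆ U →
      DifferentiableOn ℂ H U → 1 ≤ M → (∀ s ∈ closedBall (2 : ℂ) (5 / 4), ‖H s‖ ≤ M) →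
      ∀ ⦃A : ℕ → ℂ⦄, 0 ≤ A → A 1 = 1 → (∀ s : ℂ, 1 < s.re → LSeriesSummable A s) →
        (∀ s : ℂ, 1 < s.re → H s = (s - 1) * LSeries A s) →
        ∀ ⦃β : ℝ⦄, 1 - ((5 : ℝ) / 4 - 1) / 2 ≤ β → β < 1 → 0 ≤ (H β).re →
          cE * (1 - β) * M ^ (-(AE * (1 - β))) ≤ (H 1).re)
    {δ : ℝ} (hδ : 0 < δ) (hδ8 : δ ≤ 1 / 8)
    (hZ : ∀ σ : ℝ, 1 - δ ≤ σ → σ ≤ 1 → (σ : ℂ) * (σ - 1) * J σ + V / 2 ≠ 0)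
    {M : ℝ} (hM1 : 1 ≤ M)
    (hMbd : (9 / 2 * (9 / 4) * MJ + |V| / 2) * ((max 1 a) ^ (17 / 4 : ℝ) * π ^ (13 / 4 : ℝ)) *
        (KΓ ^ 2 * (∑' n : ℕ, (n : ℝ) ^ (-(3 / 2 : ℝ))) / C₁) ≤ M) :
    cE * δ * M ^ (-(AE * δ)) ≤ 3 * a ^ 2 * V / (π * C₁) := by
  have hπ := Real.pi_pos
  -- the function `H`
  set H : ℂ → ℂ := fun s ↦ (s * (s - 1) * J s + V / 2) * ((a : ℂ) ^ (s + 1) * (π : ℂ) ^ s) /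
    ((Complex.Gamma (s + 1)) ^ 2 * riemannZeta (2 * s) * C₁) with hHdef
  set U : Set ℂ := {s : ℂ | 1 / 2 < s.re} with hUdef
  have hU : IsOpen U := isOpen_lt continuous_const Complex.continuous_re
  have hsub : closedBall (2 : ℂ) (5 / 4) ⊆ U := fun s hs' ↦ by
    have := (re_bounds_of_mem_closedBall hs').1
    show 1 / 2 < s.re
    linarith
  have hHd : DifferentiableOn ℂ H U := differentiableOn_H (V := V) ha hC1 hJ
  have hHM : ∀ s ∈ closedBall (2 : ℂ) (5 / 4), ‖H s‖ ≤ M := fun s hs' ↦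
    (norm_H_le (V := V) ha hC1 hMJ hJbd hΓbd hs').trans hMbd
  -- the Dirichlet series
  set A : ℕ → ℂ := fun n ↦ (((C n / (n * C₁)) : ℝ) : ℂ) with hAdef
  have hA0 : 0 ≤ A := coeffA_nonneg hC hC1
  have hA1 : A 1 = 1 := coeffA_one hC1 h1
  have hsumA : ∀ s : ℂ, 1 < s.re → LSeriesSummable A s := fun s hs1 ↦
    LSeriesSummable_coeffA hC1 (hsum s hs1)
  have hL : ∀ s : ℂ, 1 < s.re → H s = (s - 1) * LSeries A s := fun s hs1 ↦
    H_eq_sub_one_mul_LSeries ha hC1 hJeq hs1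
  -- the value at `1`
  have hH1 : H 1 = ((3 * a ^ 2 * V / (π * C₁) : ℝ) : ℂ) := H_one (J := J) (V := V) ha hC1
  have hH1re : (H 1).re = 3 * a ^ 2 * V / (π * C₁) := by rw [hH1, Complex.ofReal_re]
  have hH1pos : 0 < (H 1).re := by rw [hH1re]; positivity
  -- zero-freeness on `[1 - δ, 1]` gives `Re H(1 - δ) ≥ 0`
  have hcont : ContinuousOn (fun σ : ℝ ↦ H σ) (Icc (1 - δ) 1) := by
    refine hHd.continuousOn.comp Complex.continuous_ofReal.continuousOn fun σ hσ ↦ ?_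
    show 1 / 2 < (σ : ℂ).re
    rw [Complex.ofReal_re]
    linarith [hσ.1]
  have him : ∀ σ ∈ Icc (1 - δ) 1, (H σ).im = 0 := fun σ hσ ↦
    H_ofReal_im (C₁ := C₁) (V := V) ha hJreal (by linarith [hσ.1])
  have hne : ∀ σ ∈ Icc (1 - δ) 1, H σ ≠ 0 := by
    intro σ hσ
    have hZσ := hZ σ hσ.1 hσ.2
    have hac : (a : ℂ) ≠ 0 := by exact_mod_cast ha.ne'
    have hπc : (π : ℂ) ≠ 0 := by exact_mod_cast hπ.ne'
    have hC1c : (C₁ : ℂ) ≠ 0 := by exact_mod_cast hC1.ne'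
    have has : (a : ℂ) ^ ((σ : ℂ) + 1) ≠ 0 := by
      rw [Ne, Complex.cpow_eq_zero_iff]; exact fun h ↦ hac h.1
    have hπs : (π : ℂ) ^ (σ : ℂ) ≠ 0 := by
      rw [Ne, Complex.cpow_eq_zero_iff]; exact fun h ↦ hπc h.1
    have hΓ1 : Complex.Gamma ((σ : ℂ) + 1) ≠ 0 :=
      Complex.Gamma_ne_zero_of_re_pos (by simp; linarith [hσ.1])
    have hζ : riemannZeta (2 * (σ : ℂ)) ≠ 0 :=
      riemannZeta_ne_zero_of_one_le_re (by simp; linarith [hσ.1])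
    exact div_ne_zero (mul_ne_zero hZσ (mul_ne_zero has hπs))
      (mul_ne_zero (mul_ne_zero (pow_ne_zero 2 hΓ1) hζ) hC1c)
  have hHβ : 0 ≤ (H ((1 - δ : ℝ) : ℂ)).re := by
    have h1' : 0 < (H ((1 : ℝ) : ℂ)).re := by rwa [Complex.ofReal_one]
    exact (re_pos_of_forall_ne_zero (by linarith) hcont him hne h1').le
  -- Estermann's lemma
  have hβ : 1 - ((5 : ℝ) / 4 - 1) / 2 ≤ 1 - δ := by linarith
  have hβ1 : 1 - δ < 1 := by linarith
  have hE := hEst hU hsub hHd hM1 hHM hA0 hA1 hsumA hL hβ hβ1 hHβ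
  rwa [show (1 : ℝ) - (1 - δ) = δ by ring, hH1re] at hE

end Abstract

/-! ### The real-variable endgame -/

section Endgame

/-- **From Estermann's inequality to the lower bound.** If `V > 0`, `N ≥ 1`,
`c_E eta M^{-θ} ≤ 48πV/N` with `M = max(1, K N⁵ V)`, `0 < θ ≤ 1` and `6θ ≤ ε`, then
`min(c_Eeta/(48π), 1, c_EetaK^{-θ}/(48π)) · N^{1-ε} ≤ V` (case `M = 1`: `V ≥ c_EetaN/(48π)`; otherwise
`V^{1+θ} ≥ c' N^{1-5θ}` and `(1 − 5θ)/(1 + θ) ≥ 1 − 6θ`). [folklore] -/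
theorem lower_bound_of_estermann_ineq {V Nr cE eta K θ ε : ℝ} (hV : 0 < V) (hN : 1 ≤ Nr)
    (hcE : 0 < cE) (heta : 0 < eta) (hK : 0 < K) (hθ0 : 0 < θ) (hθε : 6 * θ ≤ ε)
    (h : cE * eta * (max 1 (K * Nr ^ 5 * V)) ^ (-θ) ≤ 48 * π * V / Nr) :
    min (cE * eta / (48 * π)) (min 1 (cE * eta * K ^ (-θ) / (48 * π))) * Nr ^ (1 - ε) ≤ V := by
  have hπ := Real.pi_pos
  have hN0 : 0 < Nr := by linarith
  have hNε : Nr ^ (1 - ε) ≤ Nr := by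
    conv_rhs => rw [← Real.rpow_one Nr]
    exact Real.rpow_le_rpow_of_exponent_le hN (by linarith)
  set c₁ : ℝ := cE * eta / (48 * π) with hc₁
  set c' : ℝ := cE * eta * K ^ (-θ) / (48 * π) with hc'
  have hc₁0 : 0 < c₁ := by positivity
  have hc'0 : 0 < c' := by positivity
  by_cases hM : K * Nr ^ 5 * V ≤ 1
  · -- `M = 1`
    rw [max_eq_left hM, Real.one_rpow, mul_one] at h
    -- `V ≥ c₁ N`
    have h1 : c₁ * Nr ≤ V := by
      rw [hc₁]
      rw [le_div_iff₀ hN0] at h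
      have : cE * eta / (48 * π) * Nr = cE * eta * Nr / (48 * π) := by ring
      rw [this, div_le_iff₀ (by positivity)]
      linarith
    calc min c₁ (min 1 c') * Nr ^ (1 - ε) ≤ c₁ * Nr :=
          mul_le_mul (min_le_left _ _) hNε (by positivity) hc₁0.le
      _ ≤ V := h1
  · -- `M = K N⁵ V > 1`
    push Not at hM
    rw [max_eq_right hM.le] at h
    have hKNV : 0 < K * Nr ^ 5 * V := by positivity
    -- `V^{1+θ} ≥ c' N^{1-5θ}`
    have h2 : c' * Nr ^ (1 - 5 * θ) ≤ V ^ (1 + θ) := by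
      rw [Real.mul_rpow (by positivity) hV.le, Real.mul_rpow hK.le (by positivity),
        ← Real.rpow_natCast, ← Real.rpow_mul hN0.le] at h
      -- h : cE eta (K^{-θ} N^{-5θ} V^{-θ}) ≤ 48πV/N
      rw [le_div_iff₀ hN0] at h
      have hVθ : 0 < V ^ (-θ) := Real.rpow_pos_of_pos hV _
      have e1 : V ^ (1 + θ) = V * V ^ θ := by rw [Real.rpow_add hV, Real.rpow_one]
      have e2 : V ^ θ * V ^ (-θ) = 1 := by rw [← Real.rpow_add hV]; simp
      have e3 : Nr ^ (1 - 5 * θ) = Nr * Nr ^ ((5 : ℕ) * -θ) := by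
        rw [show (1 - 5 * θ) = 1 + (5 : ℕ) * -θ by push_cast; ring, Real.rpow_add hN0, Real.rpow_one]
      rw [hc', e1, e3]
      -- want: cE eta K^{-θ}/(48π) · N · N^{-5θ} ≤ V V^θ ; from h: cE eta K^{-θ} N^{-5θ} V^{-θ} N ≤ 48 π V
      have key : cE * eta * (K ^ (-θ) * Nr ^ ((5 : ℕ) * -θ) * V ^ (-θ)) * Nr * V ^ θ ≤ 48 * π * V * V ^ θ :=
        mul_le_mul_of_nonneg_right h (Real.rpow_nonneg hV.le _)
      have e4 : cE * eta * (K ^ (-θ) * Nr ^ ((5 : ℕ) * -θ) * V ^ (-θ)) * Nr * V ^ θ =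
          (cE * eta * K ^ (-θ) * (Nr * Nr ^ ((5 : ℕ) * -θ))) * (V ^ θ * V ^ (-θ)) := by ring
      rw [e4, e2, mul_one] at key
      rw [div_mul_eq_mul_div, div_le_iff₀ (by positivity)]
      linarith
    -- take the `1/(1+θ)`-th power
    have h1θ : 0 < 1 + θ := by linarith
    have h3 : (c' * Nr ^ (1 - 5 * θ)) ^ (1 + θ)⁻¹ ≤ V := by
      calc (c' * Nr ^ (1 - 5 * θ)) ^ (1 + θ)⁻¹ ≤ (V ^ (1 + θ)) ^ (1 + θ)⁻¹ :=
            Real.rpow_le_rpow (by positivity) h2 (by positivity)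
        _ = V := Real.rpow_rpow_inv hV.le h1θ.ne'
    -- lower bound for the left side
    have h4 : min 1 c' * Nr ^ (1 - ε) ≤ (c' * Nr ^ (1 - 5 * θ)) ^ (1 + θ)⁻¹ := by
      rw [Real.mul_rpow hc'0.le (by positivity), ← Real.rpow_mul hN0.le]
      have hp1 : (1 + θ)⁻¹ ≤ 1 := inv_le_one_of_one_le₀ (by linarith)
      have hp0 : 0 < (1 + θ)⁻¹ := by positivity
      have hcmin : min 1 c' ≤ c' ^ (1 + θ)⁻¹ := by
        by_cases hc1 : c' ≤ 1
        · calc min 1 c' ≤ c' := min_le_right _ _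
            _ = c' ^ (1 : ℝ) := (Real.rpow_one _).symm
            _ ≤ c' ^ (1 + θ)⁻¹ := Real.rpow_le_rpow_of_exponent_ge hc'0 hc1 hp1
        · push Not at hc1
          exact (min_le_left _ _).trans (Real.one_le_rpow hc1.le hp0.le)
      have hexp : 1 - ε ≤ (1 - 5 * θ) * (1 + θ)⁻¹ := by
        rw [← div_eq_mul_inv, le_div_iff₀ h1θ]
        nlinarith
      have hNexp : Nr ^ (1 - ε) ≤ Nr ^ ((1 - 5 * θ) * (1 + θ)⁻¹) :=
        Real.rpow_le_rpow_of_exponent_le hN hexp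
      exact mul_le_mul hcmin hNexp (by positivity) (by positivity)
    calc min c₁ (min 1 c') * Nr ^ (1 - ε) ≤ min 1 c' * Nr ^ (1 - ε) :=
          mul_le_mul_of_nonneg_right (min_le_right _ _) (by positivity)
      _ ≤ (c' * Nr ^ (1 - 5 * θ)) ^ (1 + θ)⁻¹ := h4
      _ ≤ V := h3

/-- **From Estermann's inequality to the effective lower bound.** If `V > 0`, `N ≥ 1`, `K ≥ 1`,
`c_E δ M^{-A_Eδ} ≤ 48πV/N` with `M = max(1, K N⁵ V)`, `0 < δ ≤ 1` and `δ log(K N⁶) ≤ 1`, then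
`min(c_E/(48π), 1, c_E e^{-A_E}/(48π)) · δ N ≤ V` (with `v = V/N`: if `KN⁶v ≤ 1` then
`v ≥ c_Eδ/(48π)`; if `v ≥ 1` then `V ≥ N`; otherwise `log M ≤ log(KN⁶)`, so `M^{-A_Eδ} ≥ e^{-A_E}`).
[folklore] -/
theorem lower_bound_log_of_estermann_ineq {V Nr cE δ K AE : ℝ} (hV : 0 < V) (hN : 1 ≤ Nr)
    (hcE : 0 < cE) (hδ : 0 < δ) (hδ1 : δ ≤ 1) (hK : 1 ≤ K) (hAE : 0 < AE)
    (hδlog : δ * Real.log (K * Nr ^ 6) ≤ 1)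
    (h : cE * δ * (max 1 (K * Nr ^ 5 * V)) ^ (-(AE * δ)) ≤ 48 * π * V / Nr) :
    min (cE / (48 * π)) (min 1 (cE * Real.exp (-AE) / (48 * π))) * δ * Nr ≤ V := by
  have hπ := Real.pi_pos
  have hN0 : 0 < Nr := by linarith
  set m : ℝ := min (cE / (48 * π)) (min 1 (cE * Real.exp (-AE) / (48 * π))) with hm
  have hm0 : 0 < m := by positivity
  have hm1 : m ≤ cE / (48 * π) := min_le_left _ _
  have hm2 : m ≤ 1 := (min_le_right _ _).trans (min_le_left _ _)
  have hm3 : m ≤ cE * Real.exp (-AE) / (48 * π) := (min_le_right _ _).trans (min_le_right _ _)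
  rw [le_div_iff₀ hN0] at h
  by_cases hM : K * Nr ^ 5 * V ≤ 1
  · -- `M = 1`: `cE δ N ≤ 48 π V`
    rw [max_eq_left hM, Real.one_rpow, mul_one] at h
    calc m * δ * Nr ≤ cE / (48 * π) * δ * Nr := by gcongr
      _ = cE * δ * Nr / (48 * π) := by ring
      _ ≤ V := by rw [div_le_iff₀ (by positivity)]; linarith
  · push Not at hM
    rw [max_eq_right hM.le] at h
    by_cases hv : Nr ≤ V
    · -- `V ≥ N ≥ m δ N`
      calc m * δ * Nr ≤ 1 * 1 * Nr := by gcongr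
        _ = Nr := by ring
        _ ≤ V := hv
    · push Not at hv
      -- `log M ≤ log (K N⁶)`, so `M^{-AEδ} ≥ e^{-AE}`
      have hMpos : 0 < K * Nr ^ 5 * V := by positivity
      have hlogM : Real.log (K * Nr ^ 5 * V) ≤ Real.log (K * Nr ^ 6) := by
        refine Real.log_le_log hMpos ?_
        calc K * Nr ^ 5 * V ≤ K * Nr ^ 5 * Nr := by gcongr
          _ = K * Nr ^ 6 := by ring
      have hexp : Real.exp (-AE) ≤ (K * Nr ^ 5 * V) ^ (-(AE * δ)) := by
        rw [Real.rpow_def_of_pos hMpos, Real.exp_le_exp]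
        have h1 : Real.log (K * Nr ^ 5 * V) * (AE * δ) ≤ AE := by
          calc Real.log (K * Nr ^ 5 * V) * (AE * δ) ≤ Real.log (K * Nr ^ 6) * (AE * δ) := by
                have hlog0 : 0 ≤ AE * δ := by positivity
                exact mul_le_mul_of_nonneg_right hlogM hlog0
            _ = AE * (δ * Real.log (K * Nr ^ 6)) := by ring
            _ ≤ AE * 1 := by gcongr
            _ = AE := mul_one _
        linarith
      have key : cE * δ * Real.exp (-AE) * Nr ≤ 48 * π * V := by
        calc cE * δ * Real.exp (-AE) * Nr ≤ cE * δ * (K * Nr ^ 5 * V) ^ (-(AE * δ)) * Nr := by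
              gcongr
          _ ≤ 48 * π * V := h
      calc m * δ * Nr ≤ cE * Real.exp (-AE) / (48 * π) * δ * Nr := by gcongr
        _ = cE * δ * Real.exp (-AE) * Nr / (48 * π) := by ring
        _ ≤ V := by rw [div_le_iff₀ (by positivity)]; linarith

end Endgame

/-! ### The trace of a newform: the main theorem -/

section Concrete

variable {N : ℕ} [NeZero N]

omit [NeZero N] in
/-- `J₀(σ) = ∫_𝒟 G_f E₀*(·, σ) dμ` is real for real `σ` (`E₀*(w, σ) ∈ ℝ`, `Lambda₀_re_eq_integral`).
[folklore] -/
theorem im_integral_rsTrace_mul_completedEisenstein₀ (f : CuspForm (Gamma0 N) 2) (σ : ℝ) :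
    (∫ w in ModularGroup.fd, (rsTrace N 2 f w : ℂ) * completedEisenstein₀ w σ).im = 0 := by
  have hpt : ∀ w : ℍ, (rsTrace N 2 f w : ℂ) * completedEisenstein₀ w σ =
      (((rsTrace N 2 f w * (((thetaFEPair w).Λ₀ σ).re / 2)) : ℝ) : ℂ) := by
    intro w
    rw [completedEisenstein₀, (Lambda₀_re_eq_integral w σ).2, Complex.ofReal_re]
    push_cast
    ring
  simp_rw [hpt]
  rw [integral_complex_ofReal, Complex.ofReal_im]

/-- **`Z_f(s) = s(s − 1) ∫_𝒟 G_f E*(·, s) dμ`** away from `s = 0, 1`: the completed trace zeta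
function of the statements below is `s(s−1)` times the Rankin–Selberg integral of the trace
against the COMPLETED level-one Eisenstein series `E* = E₀* − 1/(2s) − 1/(2(1−s))`
(`completedEisenstein_eq`); in particular its zeros in `(1/2, 1)` are those of `∫_𝒟 G_f E*(·, s) dμ`,
the meromorphic continuation of `π^{-s}Γ(s)ζ(2s) ∫_𝒟 G_f E(·, s) dμ =
π^{-s}Γ(s)Γ(s+1)ζ(2s)(4π/N)^{-(s+1)} Σₙ rsCoeff(n) n^{-(s+1)}` (Rankin 1939). [cite: Rankin1939, §4.4] -/
theorem traceZeta_eq_mul_integral_completedEisenstein (f : CuspForm (Gamma0 N) 2) {s : ℂ}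
    (hs0 : s ≠ 0) (hs1 : s ≠ 1) :
    s * (s - 1) * (∫ w in ModularGroup.fd, (rsTrace N 2 f w : ℂ) * completedEisenstein₀ w s) +
        (((∫ w in ModularGroup.fd, rsTrace N 2 f w : ℝ)) : ℂ) / 2 =
      s * (s - 1) * ∫ w in ModularGroup.fd, (rsTrace N 2 f w : ℂ) * completedEisenstein w s := by
  -- the datum (for the domination of `G_f E₀*`)
  have hGc : Continuous (rsTrace N 2 f) := continuous_rsTrace (ModularFormClass.continuous f)
  have hGinv : ∀ (A : SL(2, ℤ)) (τ : ℍ), rsTrace N 2 f (A • τ) = rsTrace N 2 f τ :=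
    fun A τ ↦ rsTrace_smul f A τ
  have hG0 : ∀ τ, 0 ≤ rsTrace N 2 f τ := fun τ ↦ rsTrace_nonneg _ τ
  obtain ⟨B, hB0, hB⟩ := exists_rsTrace_le f
  have hC : ∀ n, 0 ≤ rsCoeff N 2 f n := fun n ↦ rsCoeff_nonneg _ n
  have hC0 : rsCoeff N 2 f 0 = 0 := rsCoeff_zero f
  have ha : 0 < 4 * Real.pi / N := by
    have hN0 : (0 : ℝ) < N := Nat.cast_pos.mpr (NeZero.pos N)
    positivity
  have hs' : ∀ y : ℝ, 0 < y → Summable fun n : ℕ ↦ rsCoeff N 2 f n * Real.exp (-(4 * Real.pi / N) * n * y) :=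
    fun y hy ↦ summable_rsCoeff_mul_exp_datum f hy
  have hm : ∀ y : ℝ, 0 < y → ∫ x in (0 : ℝ)..1, rsTrace N 2 f (pt x y) =
      y ^ (2 : ℝ) * ∑' n : ℕ, rsCoeff N 2 f n * Real.exp (-(4 * Real.pi / N) * n * y) :=
    fun y hy ↦ horocycle_rsTrace_datum f hy
  have hκ : (0 : ℝ) ≤ 2 := by norm_num
  -- integrability of `G_f E₀*(·, s)` and of `G_f` on `𝒟`
  set σa : ℝ := -|s.re| - 1 with hσa
  set σb : ℝ := |s.re| + 2 with hσb
  have hσa0 : σa < 0 := by have := abs_nonneg s.re; linarith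
  have hσb1 : 1 < σb := by have := abs_nonneg s.re; linarith
  have hsa : σa ≤ s.re := by have := neg_abs_le s.re; linarith
  have hsb : s.re ≤ σb := by have := le_abs_self s.re; linarith
  have hbi := integrableOn_fd_majorant hGc hGinv hG0 hB hC hC0 ha hκ hs' hm
    (by linarith : (1 : ℝ) < 1 - σa) hσb1
    ‖(Real.pi : ℂ) ^ (-((1 - σa : ℝ) : ℂ)) * Complex.Gamma (1 - σa : ℝ) * riemannZeta (2 * (1 - σa : ℝ))‖
    ‖(Real.pi : ℂ) ^ (-(σb : ℂ)) * Complex.Gamma σb * riemannZeta (2 * σb)‖ ((1 / (1 - σa) + 1 / σb) / 2)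
  have hmeas : AEStronglyMeasurable (fun w : ℍ ↦ (rsTrace N 2 f w : ℂ) * completedEisenstein₀ w s)
      (volume.restrict ModularGroup.fd) := by
    have h1 : AEStronglyMeasurable (fun w : ℍ ↦ completedEisenstein₀ w s) (volume.restrict ModularGroup.fd) := by
      have := ((locallyIntegrable_Lambda₀ s).aestronglyMeasurable).restrict (s := ModularGroup.fd)
      refine (this.const_mul (1 / 2 : ℂ)).congr (ae_of_all _ fun w ↦ ?_)
      simp only [completedEisenstein₀]; ring
    exact ((Complex.continuous_ofReal.comp hGc).aestronglyMeasurable.restrict).mul h1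
  have hint₀ : Integrable (fun w : ℍ ↦ (rsTrace N 2 f w : ℂ) * completedEisenstein₀ w s)
      (volume.restrict ModularGroup.fd) := by
    refine hbi.mono' hmeas (ae_of_all _ fun w ↦ ?_)
    have hE := norm_completedEisenstein₀_le w hσa0 hσb1 hsa hsb
    rw [norm_mul, Complex.norm_real, Real.norm_of_nonneg (hG0 w)]
    exact mul_le_mul_of_nonneg_left hE (hG0 w)
  have hintG : Integrable (fun w : ℍ ↦ (rsTrace N 2 f w : ℂ)) (volume.restrict ModularGroup.fd) := by
    haveI : IsFiniteMeasure (volume.restrict ModularGroup.fd) :=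
      ⟨by rw [Measure.restrict_apply_univ]; exact volume_modular_fd_lt_top⟩
    have hconst : Integrable (fun _ : ℍ ↦ B) (volume.restrict ModularGroup.fd) := integrable_const B
    refine hconst.mono' (Complex.continuous_ofReal.comp hGc).aestronglyMeasurable.restrict
      (ae_of_all _ fun w ↦ ?_)
    rw [Complex.norm_real, Real.norm_of_nonneg (hG0 w)]
    exact hB w
  -- `E* = E₀* − 1/(2s) − 1/(2(1−s))`
  have hpt : ∀ w : ℍ, (rsTrace N 2 f w : ℂ) * completedEisenstein w s =
      (rsTrace N 2 f w : ℂ) * completedEisenstein₀ w s -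
        (1 / (2 * s) + 1 / (2 * (1 - s))) * (rsTrace N 2 f w : ℂ) := by
    intro w; rw [completedEisenstein_eq]; ring
  simp_rw [hpt]
  rw [integral_sub hint₀ (hintG.const_mul _), integral_const_mul, integral_complex_ofReal]
  have hs1' : (1 : ℂ) - s ≠ 0 := sub_ne_zero.mpr (Ne.symm hs1)
  field_simp
  ring

/-- **The Estermann inequality for the trace of a newform** (the concrete package). There are
absolute constants `c_E, A_E > 0`, `K ≥ 1` such that for every level `N`, every newform
`f ∈ S₂(Γ₀(N))` and every `0 < δ ≤ 1/8` for which `Z_f(σ) = σ(σ−1)∫_𝒟 G_f E₀*(·,σ) + ½∫_𝒟 G_f ≠ 0`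
on `[1 − δ, 1]`:
`c_E δ · max(1, K N⁵ V)^{−A_E δ} ≤ 48 π V / N`, where `V = ∫_𝒟 G_f dμ = Re (f, f) > 0`.
[cite: MontgomeryVaughan2007, §11.2 Lemma 11.13 (applied to the Rankin–Selberg zeta function)] -/
theorem exists_trace_estermann_ineq :
    ∃ cE AE K : ℝ, 0 < cE ∧ 0 < AE ∧ 1 ≤ K ∧
      ∀ (N : ℕ) [NeZero N] (f : CuspForm (Gamma0 N) 2), IsNewform0 f →
        ∀ δ : ℝ, 0 < δ → δ ≤ 1 / 8 →
        (∀ σ : ℝ, 1 - δ ≤ σ → σ ≤ 1 →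
          (σ : ℂ) * (σ - 1) * (∫ w in ModularGroup.fd, (rsTrace N 2 f w : ℂ) * completedEisenstein₀ w σ) +
            (((∫ w in ModularGroup.fd, rsTrace N 2 f w : ℝ)) : ℂ) / 2 ≠ 0) →
        cE * δ * (max 1 (K * (N : ℝ) ^ 5 * ∫ w in ModularGroup.fd, rsTrace N 2 f w)) ^ (-(AE * δ)) ≤
            48 * π * (∫ w in ModularGroup.fd, rsTrace N 2 f w) / N ∧
          0 < (∫ w in ModularGroup.fd, rsTrace N 2 f w) ∧
          (peterssonProduct (Gamma0 N) 2 f f).re = ∫ w in ModularGroup.fd, rsTrace N 2 f w := by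
  -- absolute constants
  obtain ⟨cE, AE, hcE, hAE, hEst⟩ :=
    EstermannDisc.exists_estermann_constants (R := 5 / 4) (by norm_num) (by norm_num)
  obtain ⟨Q, hQ, hQbd⟩ := exists_norm_J₀_le_uniform
  obtain ⟨KΓ, hKΓ, hΓbd⟩ := exists_norm_inv_Gamma_add_one_le
  set Kζ : ℝ := ∑' n : ℕ, (n : ℝ) ^ (-(3 / 2 : ℝ)) with hKζ
  have hKζ0 : 0 ≤ Kζ := tsum_nonneg fun n ↦ Real.rpow_nonneg (Nat.cast_nonneg n) _
  have hπ := Real.pi_pos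
  have h4π : (1 : ℝ) ≤ 4 * π := by linarith [Real.pi_gt_three]
  set K : ℝ := (9 / 2 * (9 / 4) * (Q * 16) + 1 / 2) * ((4 * π) ^ (17 / 4 : ℝ) * π ^ (13 / 4 : ℝ)) *
    (KΓ ^ 2 * Kζ) + 1 with hK
  have hK1 : 1 ≤ K := by
    rw [hK]
    have : 0 ≤ (9 / 2 * (9 / 4) * (Q * 16) + 1 / 2) * ((4 * π) ^ (17 / 4 : ℝ) * π ^ (13 / 4 : ℝ)) *
      (KΓ ^ 2 * Kζ) := by positivity
    linarith
  refine ⟨cE, AE, K, hcE, hAE, hK1, ?_⟩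
  intro N _ f hf δ hδ hδ8 hZ
  -- the datum of the trace
  have hN0 : (0 : ℝ) < N := Nat.cast_pos.mpr (NeZero.pos N)
  have hN1 : (1 : ℝ) ≤ N := by exact_mod_cast NeZero.one_le
  have hGc : Continuous (rsTrace N 2 f) := continuous_rsTrace (ModularFormClass.continuous f)
  have hGinv : ∀ (A : SL(2, ℤ)) (τ : ℍ), rsTrace N 2 f (A • τ) = rsTrace N 2 f τ :=
    fun A τ ↦ rsTrace_smul f A τ
  have hG0 : ∀ τ, 0 ≤ rsTrace N 2 f τ := fun τ ↦ rsTrace_nonneg _ τ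
  obtain ⟨B, -, hB⟩ := exists_rsTrace_le f
  have hC : ∀ n, 0 ≤ rsCoeff N 2 f n := fun n ↦ rsCoeff_nonneg _ n
  have hC0 : rsCoeff N 2 f 0 = 0 := rsCoeff_zero f
  set a : ℝ := 4 * π / N with hadef
  have ha : 0 < a := by positivity
  have hs : ∀ y : ℝ, 0 < y → Summable fun n : ℕ ↦ rsCoeff N 2 f n * Real.exp (-a * n * y) :=
    fun y hy ↦ summable_rsCoeff_mul_exp_datum f hy
  have hm : ∀ y : ℝ, 0 < y → ∫ x in (0 : ℝ)..1, rsTrace N 2 f (pt x y) =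
      y ^ (2 : ℝ) * ∑' n : ℕ, rsCoeff N 2 f n * Real.exp (-a * n * y) :=
    fun y hy ↦ horocycle_rsTrace_datum f hy
  have hle : ∀ y : ℝ, 0 < y → ∑' n : ℕ, rsCoeff N 2 f n * Real.exp (-a * n * y) ≤ B * y ^ (-(2 : ℝ)) :=
    fun y hy ↦ tsum_rsCoeff_mul_exp_le_datum f hB hy
  have hκ : (0 : ℝ) ≤ 2 := by norm_num
  -- `J`, `V`, `C₁`
  set J : ℂ → ℂ := fun s ↦ ∫ w in ModularGroup.fd, (rsTrace N 2 f w : ℂ) * completedEisenstein₀ w s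
    with hJdef
  set V : ℝ := ∫ w in ModularGroup.fd, rsTrace N 2 f w with hVdef
  have hVc : (∫ w in ModularGroup.fd, (rsTrace N 2 f w : ℂ)) = (V : ℂ) := integral_complex_ofReal
  have hVeq : (peterssonProduct (Gamma0 N) 2 f f).re = V :=
    peterssonProduct_self_re_eq_integral_rsTrace f
  have hVpos : 0 < V := by
    rw [← hVeq]
    have h := normSq_cuspCoeff_mul_le_peterssonProduct_re f one_pos
    rw [show cuspCoeff f 1 = 1 from hf.2.2] at h
    have : (0 : ℝ) < ‖(1 : ℂ)‖ ^ 2 * (Real.exp (-(4 * π * (1 : ℕ))) / (4 * π * (1 : ℕ))) := by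
      simp only [norm_one, one_pow, one_mul, Nat.cast_one, mul_one]
      positivity
    linarith
  have hC1N : (N : ℝ)⁻¹ ≤ rsCoeff N 2 f 1 := hf.inv_le_rsCoeff_one
  have hC1 : 0 < rsCoeff N 2 f 1 := lt_of_lt_of_le (inv_pos.mpr hN0) hC1N
  -- analytic properties of `J`
  have hJ : Differentiable ℂ J := differentiable_J₀ hGc hGinv hG0 hB hC hC0 ha hκ hs hm
  have hJeq : ∀ s : ℂ, 1 < s.re → J s = (π : ℂ) ^ (-s) * Complex.Gamma s * riemannZeta (2 * s) *
      (Complex.Gamma (s + 1) * (a : ℂ) ^ (-(s + 1)) * LSeries (fun n ↦ (rsCoeff N 2 f n : ℂ)) (s + 1)) +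
        (1 / (2 * s) + 1 / (2 * (1 - s))) * (V : ℂ) := by
    intro s hs1
    have h := J₀_eq_of_one_lt_re hGc hGinv hG0 hB hC hC0 ha hκ hs hle hm hs1
    have e : s + ((2 : ℝ) : ℂ) - 1 = s + 1 := by push_cast; ring
    rw [e, hVc] at h
    exact h
  have hsum : ∀ s : ℂ, 1 < s.re → LSeriesSummable (fun n ↦ (rsCoeff N 2 f n : ℂ)) (s + 1) :=
    fun s hs1 ↦ LSeriesSummable_of_horocycle hC ha hκ hs hle (by simp; linarith)
  have hJbd : ∀ s ∈ closedBall (2 : ℂ) (5 / 4), ‖J s‖ ≤ Q * (1 + a⁻¹) ^ 4 * V := by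
    intro s hs'
    obtain ⟨h1, h2, -, -⟩ := re_bounds_of_mem_closedBall hs'
    exact hQbd hGc hGinv hG0 hB hC hC0 ha hs hm (by linarith) (by linarith)
  have hJreal : ∀ σ : ℝ, (J σ).im = 0 := fun σ ↦ im_integral_rsTrace_mul_completedEisenstein₀ f σ
  -- the bound `M`
  have hMJ : 0 ≤ Q * (1 + a⁻¹) ^ 4 * V := by positivity
  have hMbd : (9 / 2 * (9 / 4) * (Q * (1 + a⁻¹) ^ 4 * V) + |V| / 2) *
      ((max 1 a) ^ (17 / 4 : ℝ) * π ^ (13 / 4 : ℝ)) *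
        (KΓ ^ 2 * (∑' n : ℕ, (n : ℝ) ^ (-(3 / 2 : ℝ))) / rsCoeff N 2 f 1) ≤
      max 1 (K * (N : ℝ) ^ 5 * V) := by
    refine le_trans ?_ (le_max_right _ _)
    have ha1 : 1 + a⁻¹ ≤ 2 * N := by
      rw [hadef, inv_div]
      have : (N : ℝ) / (4 * π) ≤ N := div_le_self hN0.le h4π
      linarith
    have ha4 : (1 + a⁻¹) ^ 4 ≤ 16 * (N : ℝ) ^ 4 := by
      calc (1 + a⁻¹) ^ 4 ≤ (2 * (N : ℝ)) ^ 4 := by gcongr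
        _ = 16 * (N : ℝ) ^ 4 := by ring
    have hmax : max 1 a ≤ 4 * π := by
      refine max_le h4π ?_
      rw [hadef]
      exact div_le_self (by positivity) hN1
    have hV' : |V| = V := abs_of_pos hVpos
    have hC1' : (KΓ ^ 2 * Kζ) / rsCoeff N 2 f 1 ≤ KΓ ^ 2 * Kζ * N := by
      rw [div_le_iff₀ hC1]
      calc KΓ ^ 2 * Kζ = KΓ ^ 2 * Kζ * ((N : ℝ)⁻¹ * N) := by field_simp
        _ = KΓ ^ 2 * Kζ * N * (N : ℝ)⁻¹ := by ring
        _ ≤ KΓ ^ 2 * Kζ * N * rsCoeff N 2 f 1 := by gcongr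
    have hfirst : 9 / 2 * (9 / 4) * (Q * (1 + a⁻¹) ^ 4 * V) + |V| / 2 ≤
        (9 / 2 * (9 / 4) * (Q * 16) + 1 / 2) * (N : ℝ) ^ 4 * V := by
      rw [hV']
      have hN4 : (1 : ℝ) ≤ (N : ℝ) ^ 4 := one_le_pow₀ hN1
      have h1 : Q * (1 + a⁻¹) ^ 4 * V ≤ Q * (16 * (N : ℝ) ^ 4) * V := by gcongr
      nlinarith [mul_nonneg hVpos.le (sub_nonneg.mpr hN4)]
    have hsecond : (max 1 a) ^ (17 / 4 : ℝ) * π ^ (13 / 4 : ℝ) ≤ (4 * π) ^ (17 / 4 : ℝ) * π ^ (13 / 4 : ℝ) := by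
      gcongr
    calc (9 / 2 * (9 / 4) * (Q * (1 + a⁻¹) ^ 4 * V) + |V| / 2) * ((max 1 a) ^ (17 / 4 : ℝ) * π ^ (13 / 4 : ℝ)) *
          (KΓ ^ 2 * (∑' n : ℕ, (n : ℝ) ^ (-(3 / 2 : ℝ))) / rsCoeff N 2 f 1)
        ≤ ((9 / 2 * (9 / 4) * (Q * 16) + 1 / 2) * (N : ℝ) ^ 4 * V) * ((4 * π) ^ (17 / 4 : ℝ) * π ^ (13 / 4 : ℝ)) *
          (KΓ ^ 2 * Kζ * N) :=
          mul_le_mul (mul_le_mul hfirst hsecond (by positivity) (by positivity)) hC1'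
            (by positivity) (by positivity)
      _ = ((9 / 2 * (9 / 4) * (Q * 16) + 1 / 2) * ((4 * π) ^ (17 / 4 : ℝ) * π ^ (13 / 4 : ℝ)) *
          (KΓ ^ 2 * Kζ)) * (N : ℝ) ^ 5 * V := by ring
      _ ≤ K * (N : ℝ) ^ 5 * V := by
          gcongr
          rw [hK]
          linarith
  -- Estermann
  have hE : cE * δ * (max 1 (K * (N : ℝ) ^ 5 * V)) ^ (-(AE * δ)) ≤ 3 * a ^ 2 * V / (π * rsCoeff N 2 f 1) :=
    estermann_bound_of_zeroFree (J := J) hC ha hC1 rfl hVpos hJ hJeq hsum hJreal hMJ hJbd hΓbd hEst hδ hδ8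
      (fun σ h1 h2 ↦ hZ σ h1 h2) (le_max_left _ _) hMbd
  -- `3a²V/(πC₁) ≤ 48πV/N`
  refine ⟨hE.trans ?_, hVpos, hVeq⟩
  rw [hadef, div_le_div_iff₀ (by positivity) hN0]
  have hNC : 1 ≤ (N : ℝ) * rsCoeff N 2 f 1 := by
    have := mul_le_mul_of_nonneg_left hC1N hN0.le
    rwa [mul_inv_cancel₀ hN0.ne'] at this
  have e : 3 * (4 * π / N) ^ 2 * V * N = 48 * π * V * π / N := by
    field_simp
    ring
  rw [e, div_le_iff₀ hN0]
  nlinarith [mul_pos (mul_pos (mul_pos (by norm_num : (0 : ℝ) < 48) hπ) hVpos) hπ]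

/-- **Murty's lower bound for a newform whose Rankin–Selberg trace zeta function has no
exceptional real zero (Siegel's theorem for `f × f̄` in the level aspect, case A; power form).**
For every `ε > 0` there is `δ₁ > 0` such that for every `0 < δ ≤ δ₁` there is `c = c(ε, δ) > 0`
with the following property: for every level `N` and every newform `f ∈ S₂(Γ₀(N))` (`IsNewform0 f`)
whose completed trace zeta function
`Z_f(s) = s(s−1) ∫_𝒟 G_f E₀*(·,s) dμ + ½∫_𝒟 G_f dμ` (`= s(s−1)∫_𝒟 G_f E*(·,s) dμ`, entire; for
`Re s > 1` equal to `s(s−1)π^{-s}Γ(s)Γ(s+1)ζ(2s)(4π/N)^{-(s+1)} Σₙ rsCoeff(n) n^{-(s+1)}`, and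
`Z_f(1) = (f,f)/2 > 0`) has no zero on the real segment `[1 − δ, 1]`, one has
`c N^{1−ε} ≤ Re (f, f)_{Γ₀(N)}` (`exists_trace_estermann_ineq` and `lower_bound_of_estermann_ineq`).
This is the level-aspect analogue for `L(s, f × f̄)` of "`L(1, χ) ≫_ε q^{-ε}` unless `L(s, χ)` has
an exceptional zero" (Montgomery–Vaughan §11.2); the complementary case (an exceptional zero) is
Siegel's ineffective argument, which for `f × f̄` needs `L(s, Sym² f × Sym² g)`
(Hoffstein–Lockhart 1994) and is not formalized.
[cite: HoffsteinLockhart1994, Thm. 0.1 (the unconditional statement; here only the case of no exceptional zero)] -/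
theorem IsNewform0.petersson_lower_bound_of_zeroFree {ε : ℝ} (hε : 0 < ε) :
    ∃ δ₁ : ℝ, 0 < δ₁ ∧ ∀ δ : ℝ, 0 < δ → δ ≤ δ₁ → ∃ c : ℝ, 0 < c ∧
      ∀ (N : ℕ) [NeZero N] (f : CuspForm (Gamma0 N) 2), IsNewform0 f →
        (∀ σ : ℝ, 1 - δ ≤ σ → σ ≤ 1 →
          (σ : ℂ) * (σ - 1) * (∫ w in ModularGroup.fd, (rsTrace N 2 f w : ℂ) * completedEisenstein₀ w σ) +
            (((∫ w in ModularGroup.fd, rsTrace N 2 f w : ℝ)) : ℂ) / 2 ≠ 0) →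
        c * (N : ℝ) ^ (1 - ε) ≤ (peterssonProduct (Gamma0 N) 2 f f).re := by
  obtain ⟨cE, AE, K, hcE, hAE, hK1, hineq⟩ := exists_trace_estermann_ineq
  have hπ := Real.pi_pos
  have hK0 : 0 < K := by linarith
  refine ⟨min (1 / 8) (ε / (6 * AE)), by positivity, ?_⟩
  intro δ hδ hδ1
  have hδ8 : δ ≤ 1 / 8 := hδ1.trans (min_le_left _ _)
  have hδε : δ ≤ ε / (6 * AE) := hδ1.trans (min_le_right _ _)
  have hθ0 : 0 < AE * δ := by positivity
  have hθε : 6 * (AE * δ) ≤ ε := by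
    rw [le_div_iff₀ (by positivity)] at hδε; linarith
  refine ⟨min (cE * δ / (48 * π)) (min 1 (cE * δ * K ^ (-(AE * δ)) / (48 * π))), by positivity, ?_⟩
  intro N _ f hf hZ
  have hN1 : (1 : ℝ) ≤ N := by exact_mod_cast NeZero.one_le
  obtain ⟨hfin, hVpos, hVeq⟩ := hineq N f hf δ hδ hδ8 hZ
  rw [hVeq]
  exact lower_bound_of_estermann_ineq hVpos hN1 hcE hδ hK0 hθ0 hθε hfin

/-- **Effective form: `(f, f) ≫ N / log N` unless the trace zeta function has a real zero
within `1/(A₀ log(N+2))` of `1`** (the level-aspect analogue of `L(1, χ) ≫ 1/log q` in the absence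
of a Siegel zero; Hoffstein–Lockhart 1994, p. 161: "it is easy to show `1/log N ≪ L(1, Sym² f)`
provided there is no Siegel zero"). There are absolute `A₀, c > 0` such that for every `N` and every
newform `f ∈ S₂(Γ₀(N))` with `Z_f(σ) ≠ 0` for `1 − 1/(A₀ log(N+2)) ≤ σ ≤ 1`:
`c N / log(N+2) ≤ Re (f, f)_{Γ₀(N)}` (Estermann with `δ = 1/(A₀ log(N+2))`, where
`A₀ log(N+2) ≥ max(8, log(KN⁶))`; `lower_bound_log_of_estermann_ineq`).
[cite: HoffsteinLockhart1994, p. 161 and Thm. 0.1] -/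
theorem IsNewform0.petersson_lower_bound_log_of_zeroFree :
    ∃ A₀ : ℝ, 0 < A₀ ∧ ∃ c : ℝ, 0 < c ∧
      ∀ (N : ℕ) [NeZero N] (f : CuspForm (Gamma0 N) 2), IsNewform0 f →
        (∀ σ : ℝ, 1 - 1 / (A₀ * Real.log (N + 2)) ≤ σ → σ ≤ 1 →
          (σ : ℂ) * (σ - 1) * (∫ w in ModularGroup.fd, (rsTrace N 2 f w : ℂ) * completedEisenstein₀ w σ) +
            (((∫ w in ModularGroup.fd, rsTrace N 2 f w : ℝ)) : ℂ) / 2 ≠ 0) →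
        c * N / Real.log (N + 2) ≤ (peterssonProduct (Gamma0 N) 2 f f).re := by
  obtain ⟨cE, AE, K, hcE, hAE, hK1, hineq⟩ := exists_trace_estermann_ineq
  have hπ := Real.pi_pos
  have hlog2 : (1 : ℝ) / 2 < Real.log 2 := by
    have := Real.log_two_gt_d9; linarith
  have hlogK : 0 ≤ Real.log K := Real.log_nonneg hK1
  -- `A₀ log(N+2) ≥ max(8, log K + 6 log(N+2))`
  set A₀ : ℝ := 16 + 2 * Real.log K + 6 with hA₀def
  have hA₀ : 0 < A₀ := by positivity
  set m : ℝ := min (cE / (48 * π)) (min 1 (cE * Real.exp (-AE) / (48 * π))) with hm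
  have hm0 : 0 < m := by positivity
  refine ⟨A₀, hA₀, m / A₀, by positivity, ?_⟩
  intro N _ f hf hZ
  have hN0 : (0 : ℝ) < N := Nat.cast_pos.mpr (NeZero.pos N)
  have hN1 : (1 : ℝ) ≤ N := by exact_mod_cast NeZero.one_le
  have hlogN : Real.log 2 ≤ Real.log (N + 2) := Real.log_le_log (by norm_num) (by linarith)
  have hlogN0 : 0 < Real.log (N + 2) := by linarith
  have hlogN' : Real.log N ≤ Real.log (N + 2) := Real.log_le_log hN0 (by linarith)
  have hlogNn : 0 ≤ Real.log N := Real.log_nonneg hN1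
  set δ : ℝ := 1 / (A₀ * Real.log (N + 2)) with hδdef
  have hδ : 0 < δ := by positivity
  have hAlog : 8 ≤ A₀ * Real.log (N + 2) := by
    have : 16 * Real.log 2 ≤ A₀ * Real.log (N + 2) := by
      calc 16 * Real.log 2 ≤ 16 * Real.log (N + 2) := by gcongr
        _ ≤ A₀ * Real.log (N + 2) := by
            apply mul_le_mul_of_nonneg_right _ hlogN0.le
            rw [hA₀def]; linarith
    linarith
  have hδ8 : δ ≤ 1 / 8 := by
    rw [hδdef]; exact one_div_le_one_div_of_le (by norm_num) hAlog
  have hδ1 : δ ≤ 1 := by linarith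
  have hδlog : δ * Real.log (K * (N : ℝ) ^ 6) ≤ 1 := by
    rw [hδdef, Real.log_mul (by linarith) (by positivity), Real.log_pow, one_div_mul_eq_div,
      div_le_one (by positivity)]
    calc Real.log K + (6 : ℕ) * Real.log N ≤ Real.log K + 6 * Real.log (N + 2) := by
          push_cast; gcongr
      _ ≤ A₀ * Real.log (N + 2) := by
          rw [hA₀def]
          nlinarith [mul_nonneg hlogK hlogN0.le, hlog2]
  obtain ⟨hfin, hVpos, hVeq⟩ := hineq N f hf δ hδ hδ8 (by simpa [hδdef] using hZ)
  have h := lower_bound_log_of_estermann_ineq hVpos hN1 hcE hδ hδ1 hK1 hAE hδlog hfin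
  rw [hVeq]
  calc m / A₀ * N / Real.log (N + 2) = m * δ * N := by
        rw [hδdef]; field_simp
    _ ≤ _ := h


/-- **Effective form with an arbitrary zero-free constant.** There is an absolute `A₀ > 0` such
that for EVERY `A ≥ A₀` there is `c = c(A) > 0` with: for every `N` and every newform
`f ∈ S₂(Γ₀(N))` whose trace zeta function `Z_f` has no zero on `[1 − 1/(A log(N+2)), 1]`,
`c N/log(N+2) ≤ Re (f, f)_{Γ₀(N)}`. (The larger `A`, the narrower the interval, i.e. the weaker the
hypothesis — this is the shape of a published zero-free region "`β ≤ 1 − c/log N`" with `c = 1/A`.)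
[cite: HoffsteinLockhart1994, p. 161 and Thm. 0.1] -/
theorem IsNewform0.petersson_lower_bound_log_of_zeroFree' :
    ∃ A₀ : ℝ, 0 < A₀ ∧ ∀ A : ℝ, A₀ ≤ A → ∃ c : ℝ, 0 < c ∧
      ∀ (N : ℕ) [NeZero N] (f : CuspForm (Gamma0 N) 2), IsNewform0 f →
        (∀ σ : ℝ, 1 - 1 / (A * Real.log (N + 2)) ≤ σ → σ ≤ 1 →
          (σ : ℂ) * (σ - 1) * (∫ w in ModularGroup.fd, (rsTrace N 2 f w : ℂ) * completedEisenstein₀ w σ) +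
            (((∫ w in ModularGroup.fd, rsTrace N 2 f w : ℝ)) : ℂ) / 2 ≠ 0) →
        c * N / Real.log (N + 2) ≤ (peterssonProduct (Gamma0 N) 2 f f).re := by
  obtain ⟨cE, AE, K, hcE, hAE, hK1, hineq⟩ := exists_trace_estermann_ineq
  have hπ := Real.pi_pos
  have hlog2 : (1 : ℝ) / 2 < Real.log 2 := by
    have := Real.log_two_gt_d9; linarith
  have hlogK : 0 ≤ Real.log K := Real.log_nonneg hK1
  set A₀ : ℝ := 16 + 2 * Real.log K + 6 with hA₀def
  have hA₀ : 0 < A₀ := by positivity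
  set m : ℝ := min (cE / (48 * π)) (min 1 (cE * Real.exp (-AE) / (48 * π))) with hm
  have hm0 : 0 < m := by positivity
  refine ⟨A₀, hA₀, fun A hA ↦ ?_⟩
  have hApos : 0 < A := lt_of_lt_of_le hA₀ hA
  refine ⟨m / A, by positivity, ?_⟩
  intro N _ f hf hZ
  have hN0 : (0 : ℝ) < N := Nat.cast_pos.mpr (NeZero.pos N)
  have hN1 : (1 : ℝ) ≤ N := by exact_mod_cast NeZero.one_le
  have hlogN : Real.log 2 ≤ Real.log (N + 2) := Real.log_le_log (by norm_num) (by linarith)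
  have hlogN0 : 0 < Real.log (N + 2) := by linarith
  have hlogN' : Real.log N ≤ Real.log (N + 2) := Real.log_le_log hN0 (by linarith)
  have hlogNn : 0 ≤ Real.log N := Real.log_nonneg hN1
  set δ : ℝ := 1 / (A * Real.log (N + 2)) with hδdef
  have hδ : 0 < δ := by positivity
  have hAlog : 8 ≤ A * Real.log (N + 2) := by
    have : 16 * Real.log 2 ≤ A * Real.log (N + 2) := by
      calc 16 * Real.log 2 ≤ 16 * Real.log (N + 2) := by gcongr
        _ ≤ A * Real.log (N + 2) := by
            apply mul_le_mul_of_nonneg_right _ hlogN0.le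
            rw [hA₀def] at hA; linarith
    linarith
  have hδ8 : δ ≤ 1 / 8 := by
    rw [hδdef]; exact one_div_le_one_div_of_le (by norm_num) hAlog
  have hδ1 : δ ≤ 1 := by linarith
  have hδlog : δ * Real.log (K * (N : ℝ) ^ 6) ≤ 1 := by
    rw [hδdef, Real.log_mul (by linarith) (by positivity), Real.log_pow, one_div_mul_eq_div,
      div_le_one (by positivity)]
    calc Real.log K + (6 : ℕ) * Real.log N ≤ Real.log K + 6 * Real.log (N + 2) := by
          push_cast; gcongr
      _ ≤ A₀ * Real.log (N + 2) := by
          rw [hA₀def]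
          nlinarith [mul_nonneg hlogK hlogN0.le, hlog2]
      _ ≤ A * Real.log (N + 2) := mul_le_mul_of_nonneg_right hA hlogN0.le
  obtain ⟨hfin, hVpos, hVeq⟩ := hineq N f hf δ hδ hδ8 (by simpa [hδdef] using hZ)
  have h := lower_bound_log_of_estermann_ineq hVpos hN1 hcE hδ hδ1 hK1 hAE hδlog hfin
  rw [hVeq]
  calc m / A * N / Real.log (N + 2) = m * δ * N := by
        rw [hδdef]; field_simp
    _ ≤ _ := h


/-- **The same for the newform of an elliptic curve over `ℚ`** (`IsNewformOf W f`).
[cite: HoffsteinLockhart1994, Thm. 0.1 (case of no exceptional zero)] -/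
theorem IsNewformOf.petersson_lower_bound_of_zeroFree {ε : ℝ} (hε : 0 < ε) :
    ∃ δ₁ : ℝ, 0 < δ₁ ∧ ∀ δ : ℝ, 0 < δ → δ ≤ δ₁ → ∃ c : ℝ, 0 < c ∧
      ∀ (N : ℕ) [NeZero N] (W : WeierstrassCurve ℚ) (f : CuspForm (Gamma0 N) 2), IsNewformOf W f →
        (∀ σ : ℝ, 1 - δ ≤ σ → σ ≤ 1 →
          (σ : ℂ) * (σ - 1) * (∫ w in ModularGroup.fd, (rsTrace N 2 f w : ℂ) * completedEisenstein₀ w σ) +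
            (((∫ w in ModularGroup.fd, rsTrace N 2 f w : ℝ)) : ℂ) / 2 ≠ 0) →
        c * (N : ℝ) ^ (1 - ε) ≤ (peterssonProduct (Gamma0 N) 2 f f).re := by
  obtain ⟨δ₁, hδ₁, h⟩ := IsNewform0.petersson_lower_bound_of_zeroFree hε
  refine ⟨δ₁, hδ₁, fun δ hδ hδδ ↦ ?_⟩
  obtain ⟨c, hc, hcN⟩ := h δ hδ hδδ
  exact ⟨c, hc, fun N _ W f hf hZ ↦ hcN N f hf.1 hZ⟩

/-- **`murty_petersson_newform_lower_bound` holds if no trace zeta function of the newform of an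
elliptic curve over `ℚ` has an exceptional real zero**: if there is ONE `δ₀ > 0` such that for
every `N`, every `E/ℚ` and its newform `f ∈ S₂(Γ₀(N))`, `Z_f(σ) ≠ 0` for `σ ∈ [1 − δ₀, 1]`, then
`(f, f) ≫_ε N^{1−ε}` for every `ε > 0` (take `δ = min(δ₀, δ₁(ε))`). By Goldfeld–Hoffstein–Lieman
(appendix to Hoffstein–Lockhart 1994) `L(s, Sym² f)` has no exceptional zero, and the full
Hoffstein–Lockhart theorem also covers the exceptional case (Siegel's argument); neither is
formalized here, so this is a CONDITIONAL discharge of the named fact.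
[cite: HoffsteinLockhart1994, Thm. 0.1 and Appendix] -/
theorem murty_petersson_newform_lower_bound_of_trace_zeroFree
    (h : ∃ δ₀ : ℝ, 0 < δ₀ ∧ ∀ (N : ℕ) [NeZero N] (W : WeierstrassCurve ℚ) (f : CuspForm (Gamma0 N) 2),
      IsNewformOf W f → ∀ σ : ℝ, 1 - δ₀ ≤ σ → σ ≤ 1 →
        (σ : ℂ) * (σ - 1) * (∫ w in ModularGroup.fd, (rsTrace N 2 f w : ℂ) * completedEisenstein₀ w σ) +
          (((∫ w in ModularGroup.fd, rsTrace N 2 f w : ℝ)) : ℂ) / 2 ≠ 0) :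
    murty_petersson_newform_lower_bound := by
  intro ε hε
  obtain ⟨δ₀, hδ₀, hZ⟩ := h
  obtain ⟨δ₁, hδ₁, h1⟩ := IsNewform0.petersson_lower_bound_of_zeroFree hε
  obtain ⟨c, hc, hcN⟩ := h1 (min δ₀ δ₁) (lt_min hδ₀ hδ₁) (min_le_right _ _)
  refine ⟨c, hc, fun N _ W _ f hf ↦ hcN N f hf.1 fun σ h1σ h2σ ↦ ?_⟩
  exact hZ N W f hf σ (by linarith [min_le_left δ₀ δ₁]) h2σ

/-- **`murty_petersson_newform_lower_bound` holds if the trace zeta functions of the newforms of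
elliptic curves over `ℚ` have no exceptional zero in the classical sense**: if there is a
constant `A > 0` such that for every `N`, every `E/ℚ` and its newform `f ∈ S₂(Γ₀(N))`,
`Z_f(σ) ≠ 0` for `1 − 1/(A log(N+2)) ≤ σ ≤ 1` (a zero-free interval of de la Vallée-Poussin shape,
as supplied for `L(s, Sym² f)` by Goldfeld–Hoffstein–Lieman, appendix to Hoffstein–Lockhart 1994,
and by Hoffstein–Ramakrishnan 1995 in the CM case — not formalized), then
`Re (f,f) ≥ c N/log(N+2) ≥ c ε 3^{-ε} N^{1−ε}` for every `ε > 0`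
(`IsNewform0.petersson_lower_bound_log_of_zeroFree'`, `log(N+2) ≤ (3N)^ε/ε`, Mathlib `Real.log_le_rpow_div`).
[cite: HoffsteinLockhart1994, Thm. 0.1 and Appendix (Goldfeld–Hoffstein–Lieman)] -/
theorem murty_petersson_newform_lower_bound_of_noExceptionalZero
    (h : ∃ A : ℝ, 0 < A ∧ ∀ (N : ℕ) [NeZero N] (W : WeierstrassCurve ℚ) (f : CuspForm (Gamma0 N) 2),
      IsNewformOf W f → ∀ σ : ℝ, 1 - 1 / (A * Real.log (N + 2)) ≤ σ → σ ≤ 1 →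
        (σ : ℂ) * (σ - 1) * (∫ w in ModularGroup.fd, (rsTrace N 2 f w : ℂ) * completedEisenstein₀ w σ) +
          (((∫ w in ModularGroup.fd, rsTrace N 2 f w : ℝ)) : ℂ) / 2 ≠ 0) :
    murty_petersson_newform_lower_bound := by
  intro ε hε
  obtain ⟨A, hA, hZ⟩ := h
  obtain ⟨A₀, hA₀, h1⟩ := IsNewform0.petersson_lower_bound_log_of_zeroFree'
  obtain ⟨c, hc, hcN⟩ := h1 (max A A₀) (le_max_right _ _)
  have h3ε : (0 : ℝ) < (3 : ℝ) ^ ε := Real.rpow_pos_of_pos (by norm_num) _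
  refine ⟨c * ε / (3 : ℝ) ^ ε, by positivity, fun N _ W _ f hf ↦ ?_⟩
  have hN0 : (0 : ℝ) < N := Nat.cast_pos.mpr (NeZero.pos N)
  have hN1 : (1 : ℝ) ≤ N := by exact_mod_cast NeZero.one_le
  have hAmax : 0 < max A A₀ := lt_of_lt_of_le hA (le_max_left _ _)
  have hlogN0 : 0 < Real.log (N + 2) := Real.log_pos (by linarith)
  -- the zero-free hypothesis on the (narrower) interval for `max A A₀`
  have hZ' : ∀ σ : ℝ, 1 - 1 / (max A A₀ * Real.log (N + 2)) ≤ σ → σ ≤ 1 →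
      (σ : ℂ) * (σ - 1) * (∫ w in ModularGroup.fd, (rsTrace N 2 f w : ℂ) * completedEisenstein₀ w σ) +
        (((∫ w in ModularGroup.fd, rsTrace N 2 f w : ℝ)) : ℂ) / 2 ≠ 0 := by
    intro σ h1σ h2σ
    refine hZ N W f hf σ (le_trans ?_ h1σ) h2σ
    have : 1 / (max A A₀ * Real.log (N + 2)) ≤ 1 / (A * Real.log (N + 2)) := by
      apply one_div_le_one_div_of_le (by positivity)
      exact mul_le_mul_of_nonneg_right (le_max_left _ _) hlogN0.le
    linarith
  have hmain := hcN N f hf.1 hZ'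
  -- `log(N+2) ≤ (3N)^ε/ε`
  have hlog : Real.log (N + 2) ≤ (3 : ℝ) ^ ε * (N : ℝ) ^ ε / ε := by
    have h1 : Real.log ((N : ℝ) + 2) ≤ ((N : ℝ) + 2) ^ ε / ε := Real.log_le_rpow_div (by positivity) hε
    have h2 : ((N : ℝ) + 2) ^ ε ≤ (3 * (N : ℝ)) ^ ε :=
      Real.rpow_le_rpow (by linarith) (by linarith) hε.le
    rw [Real.mul_rpow (by norm_num) hN0.le] at h2
    calc Real.log ((N : ℝ) + 2) ≤ ((N : ℝ) + 2) ^ ε / ε := h1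
      _ ≤ (3 : ℝ) ^ ε * (N : ℝ) ^ ε / ε := by gcongr
  calc c * ε / (3 : ℝ) ^ ε * (N : ℝ) ^ (1 - ε)
      = c * N / ((3 : ℝ) ^ ε * (N : ℝ) ^ ε / ε) := by
        rw [Real.rpow_sub hN0, Real.rpow_one]
        field_simp
    _ ≤ c * N / Real.log (N + 2) := by
        apply div_le_div_of_nonneg_left (by positivity) hlogN0 hlog
    _ ≤ (peterssonProduct (Gamma0 N) 2 f f).re := hmain

end Concrete

end Literature.NumberTheory.EllipticCurves.ModularForms
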